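import Summits.NavierStokesRegularity.NavierStokesRegularity.Theorems.QuantisedSymmetryQuantisedOrderRotation
import Literature.Analysis.FluidPDE.PineauVicolAngularMean
import Literature.Analysis.FluidPDE.AxisymHouLiVariables
import HarnessLib

/-!
# Route QuantisedSymmetry, item `QuantisedOrder` (stmt-NavierStokesRegularity-11293) — III:
# the SO(2)-average — an a.e.-axisymmetric field has a POINTWISE axisymmetric representative

**Proposition.** Let `u : ℝ → ℝ³ → ℝ³` be a.e. strongly measurable on a parabolic ball
`Q = Q(0, R)` and a.e. equivariant there under every rotation about the `x₃`-axis
(`u(t, R_θ x) = R_θ u(t, x)` for a.e. `(t, x) ∈ Q`, for each `θ`). Then there is a field `ū` whose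
every slice `ū(t, ·)` is axisymmetric at EVERY point (`IsAxisymmetric`, the pointwise notion of
`AxisymmetricEuler.lean`) and which agrees with `u` a.e. on `Q`.

*Construction.* Replace `u` by a strongly measurable representative `ũ` vanishing off `Q`
(still a.e. equivariant, now on all of `ℝ × ℝ³`), and average over the orbit:
`ū(t, x) = (2π)⁻¹ ∫₀^{2π} R_{-θ} ũ(t, R_θ x) dθ` — the tree's `angularMeanVec` (Pineau–Vicol's
`⟨·⟩_θ`), which is axisymmetric with NO hypothesis on the field (`isAxisymmetric_angularMeanVec`).
By Fubini on `ℝ_θ × (ℝ × ℝ³)` (`Measure.ae_ae_comm`), for a.e. `(t, x)` the integrand equals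
`ũ(t, x)` for a.e. `θ`, so `ū = ũ = u` a.e. on `Q`.

Measure theory only; nothing here is specific to the Navier–Stokes equations.

## References

* B. Pineau, V. Vicol, arXiv:2607.09619, §6.1 (6.4) (the angular mean). [PineauVicol2026]
* G. Seregin, V. Šverák, Comm. PDE 34 (2009) = arXiv:0804.1803, §3. [SereginSverak2009]
-/

set_option linter.dupNamespace false

noncomputable section

open MeasureTheory Set Function Filter Topology Metric
open scoped ENNReal NNReal

namespace Summit.NavierStokesRegularity.NavierStokesRegularity.Theorems.QuantisedOrder

open Literature.Analysis.FluidPDE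

/-- **Averaging identity.** If `ũ : ℝ × ℝ³ → ℝ³` is strongly measurable and, for every angle `θ`,
`ũ(t, R_θ x) = R_θ ũ(t, x)` for a.e. `(t, x) ∈ ℝ × ℝ³`, then the orbit average
`(t, x) ↦ ⟨ũ(t, ·)⟩_θ(x)` (`angularMeanVec`) agrees with `ũ` almost everywhere (Fubini in the angle).
[folklore] -/
theorem angularMeanVec_ae_eq_of_ae_equivariant
    {ut : ℝ × EuclideanSpace ℝ (Fin 3) → EuclideanSpace ℝ (Fin 3)} (hutm : StronglyMeasurable ut)
    (hsym : ∀ θ : ℝ, ∀ᵐ z ∂(volume : Measure (ℝ × EuclideanSpace ℝ (Fin 3))),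
      ut (z.1, rotZ θ z.2) = rotZ θ (ut z)) :
    ∀ᵐ z ∂(volume : Measure (ℝ × EuclideanSpace ℝ (Fin 3))),
      angularMeanVec (fun y => ut (z.1, y)) z.2 = ut z := by
  -- the defect `H(θ, z) = R_{-θ} ũ(t, R_θ x) - ũ(t, x)` is jointly measurable
  obtain ⟨H, hH⟩ : ∃ H : ℝ × (ℝ × EuclideanSpace ℝ (Fin 3)) → EuclideanSpace ℝ (Fin 3),
      ∀ q, H q = rotZ (-q.1) (ut (q.2.1, rotZ q.1 q.2.2)) - ut q.2 := ⟨_, fun q => rfl⟩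
  have hm1 : Measurable fun q : ℝ × (ℝ × EuclideanSpace ℝ (Fin 3)) => (q.2.1, rotZ q.1 q.2.2) :=
    (continuous_snd.fst.prodMk
      (continuous_rotZ_uncurry'.comp (continuous_fst.prodMk continuous_snd.snd))).measurable
  have hm2 : Measurable fun q : ℝ × (ℝ × EuclideanSpace ℝ (Fin 3)) => ut (q.2.1, rotZ q.1 q.2.2) :=
    hutm.measurable.comp hm1
  -- (elaborated without expected type: unifying `?g ∘ ?f` against the target lambda is costly)
  have hm3 := continuous_rotZ_uncurry'.measurable.comp (measurable_fst.neg.prodMk hm2)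
  have hHm : Measurable H := by
    have e : H = fun q => ((fun p : ℝ × EuclideanSpace ℝ (Fin 3) => rotZ p.1 p.2) ∘
        fun q : ℝ × (ℝ × EuclideanSpace ℝ (Fin 3)) => (-q.1, ut (q.2.1, rotZ q.1 q.2.2))) q - ut q.2 := by
      funext q; rw [hH]; rfl
    rw [e]
    exact hm3.sub (hutm.measurable.comp measurable_snd)
  -- for each angle it vanishes a.e.
  have hHθ : ∀ θ : ℝ, ∀ᵐ z ∂(volume : Measure (ℝ × EuclideanSpace ℝ (Fin 3))), H (θ, z) = 0 := by
    intro θ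
    filter_upwards [hsym θ] with z hz
    rw [hH]
    dsimp only
    rw [hz, rotZ_neg_apply_rotZ, sub_self]
  -- Fubini: swap the quantifiers
  have hset : MeasurableSet {q : ℝ × (ℝ × EuclideanSpace ℝ (Fin 3)) | H (q.1, q.2) = 0} :=
    hHm (measurableSet_singleton 0)
  have hswap : ∀ᵐ z ∂(volume : Measure (ℝ × EuclideanSpace ℝ (Fin 3))),
      ∀ᵐ θ ∂(volume : Measure ℝ), H (θ, z) = 0 :=
    (Measure.ae_ae_comm (μ := (volume : Measure ℝ))
      (ν := (volume : Measure (ℝ × EuclideanSpace ℝ (Fin 3))))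
      (p := fun θ z => H (θ, z) = 0) hset).1 (Eventually.of_forall hHθ)
  filter_upwards [hswap] with z hz
  rw [angularMeanVec_apply]
  have hc : ∫ θ in (0 : ℝ)..2 * Real.pi, rotZ (-θ) (ut (z.1, rotZ θ z.2)) =
      ∫ θ in (0 : ℝ)..2 * Real.pi, ut z := by
    refine intervalIntegral.integral_congr_ae (hz.mono fun θ hθ _ => ?_)
    have hθ' : rotZ (-θ) (ut (z.1, rotZ θ z.2)) - ut z = 0 := by
      have := hH (θ, z)
      rw [hθ] at this
      exact this.symm
    exact sub_eq_zero.1 hθ'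
  rw [hc, intervalIntegral.integral_const, sub_zero, smul_smul,
    inv_mul_cancel₀ (by positivity), one_smul]

/-- **Pointwise axisymmetric representative.** An a.e. strongly measurable field on `Q(0, R)`
which is a.e. equivariant there under every rotation about the axis agrees a.e. on `Q(0, R)` with a
field all of whose slices are (pointwise) axisymmetric. [folklore] -/
theorem exists_axisymmetric_repr {R : ℝ}
    {u : ℝ → EuclideanSpace ℝ (Fin 3) → EuclideanSpace ℝ (Fin 3)}
    (hum : AEStronglyMeasurable (uncurry u)
      ((volume : Measure (ℝ × EuclideanSpace ℝ (Fin 3))).restrict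
        (parabolicCylinder R (0 : ℝ × EuclideanSpace ℝ (Fin 3)))))
    (hsym : ∀ θ : ℝ, ∀ᵐ z ∂((volume : Measure (ℝ × EuclideanSpace ℝ (Fin 3))).restrict
        (parabolicCylinder R (0 : ℝ × EuclideanSpace ℝ (Fin 3)))),
      u z.1 (rotZ θ z.2) = rotZ θ (u z.1 z.2)) :
    ∃ ub : ℝ → EuclideanSpace ℝ (Fin 3) → EuclideanSpace ℝ (Fin 3),
      (∀ t, IsAxisymmetric (ub t)) ∧
      ∀ᵐ z ∂((volume : Measure (ℝ × EuclideanSpace ℝ (Fin 3))).restrict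
          (parabolicCylinder R (0 : ℝ × EuclideanSpace ℝ (Fin 3)))),
        uncurry u z = uncurry ub z := by
  set Q := parabolicCylinder R (0 : ℝ × EuclideanSpace ℝ (Fin 3)) with hQ
  have hQm : MeasurableSet Q := (isOpen_parabolicCylinder R _).measurableSet
  -- a strongly measurable representative vanishing off `Q`
  set ut : ℝ × EuclideanSpace ℝ (Fin 3) → EuclideanSpace ℝ (Fin 3) :=
    Q.indicator (hum.mk (uncurry u)) with hut
  have hutm : StronglyMeasurable ut := hum.stronglyMeasurable_mk.indicator hQm
  have hff' := hum.ae_eq_mk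
  have hu_ut : ∀ᵐ z ∂((volume : Measure (ℝ × EuclideanSpace ℝ (Fin 3))).restrict Q),
      uncurry u z = ut z := by
    filter_upwards [hff', ae_restrict_mem hQm] with z h1 h2
    rw [hut, indicator_of_mem h2]
    exact h1
  -- it is a.e. equivariant on the whole space
  have hut_sym : ∀ θ : ℝ, ∀ᵐ z ∂(volume : Measure (ℝ × EuclideanSpace ℝ (Fin 3))),
      ut (z.1, rotZ θ z.2) = rotZ θ (ut z) := by
    intro θ
    refine ae_of_ae_restrict_of_ae_restrict_compl Q ?_ ?_
    · have h2 := ae_restrict_comp_prodMap_rotZ θ R hff'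
      filter_upwards [hsym θ, h2, hff', ae_restrict_mem hQm] with z e1 e2 e3 hz
      have hz' : (z.1, rotZ θ z.2) ∈ Q := mem_parabolicCylinder_zero_rotZ hz
      rw [hut, indicator_of_mem hz', indicator_of_mem hz]
      have e2' : hum.mk (uncurry u) (z.1, rotZ θ z.2) = uncurry u (z.1, rotZ θ z.2) := e2.symm
      have e3' : hum.mk (uncurry u) z = uncurry u z := e3.symm
      rw [e2', e3']
      exact e1
    · refine (ae_restrict_mem hQm.compl).mono fun z hz => ?_
      have hz' : (z.1, rotZ θ z.2) ∉ Q := by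
        intro h
        have h' := mem_parabolicCylinder_zero_rotZ (θ := -θ) h
        rw [rotZ_neg_apply_rotZ] at h'
        exact hz h'
      rw [hut, indicator_of_notMem hz', indicator_of_notMem hz]
      exact (map_zero (rotZL θ)).symm
  -- the orbit average
  refine ⟨fun t x => angularMeanVec (fun y => ut (t, y)) x,
    fun t => isAxisymmetric_angularMeanVec _, ?_⟩
  have hav := angularMeanVec_ae_eq_of_ae_equivariant hutm hut_sym
  filter_upwards [hu_ut, ae_restrict_of_ae (s := Q) hav] with z h1 h2
  rw [h1]
  exact h2.symm

end Summit.NavierStokesRegularity.NavierStokesRegularity.Theorems.QuantisedOrder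

end
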